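/-
Copyright (c) 2026 the pub-hodgecm-mathlib formalisation cell (harness21).  Prover seat hodgecm-mathlib-K2E1b-p12 (g0), Track B ∕ K2-LIT
(build stream 29), h413 = `stmt-HodgeConjecture-24833`, line `K2_E1b_GKCohomologyU21`, socket module «U23 CarriersData», file #14 — the
payment of `K2E1bGKCohomologyU21.U23.sig_K2E1bNoDegOneOfNoPTypes` TOKEN FOR TOKEN.  2026-09-03.
-/
import Summits.HodgeConjecture.HodgeConjecture.Theorems.F0P3bKTypeIntegration
import Summits.HodgeConjecture.HodgeConjecture.Theorems.F0P3bCochainValues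
import Summits.HodgeConjecture.HodgeConjecture.Theorems.F0P3bStubT6bDegOneTypeFinrank
import Literature.NumberTheory.Automorphic.GKModules
import HarnessLib

/-!
# h413 ∕ Track B «K2-LIT», line `K2_E1b_GKCohomologyU21`, unit U3: `H¹_δ = 0` WHEN THE `𝔭`-TYPES ARE ABSENT
# (payment of `Cruxes/H413/Lines/K2_E1b_GKCohomologyU21_U23_CarriersData.lean :: sig_K2E1bNoDegOneOfNoPTypes`, statement bytes frozen)

Cell `pub/hodgecm-mathlib`, crux H413 = `stmt-HodgeConjecture-24833`, route of record `HCCMUnconditional`; chair K2-lead (g0), dealer K2E1b-plan (g0),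
EMIT «SKELETON LANDED K2E1b» (REQUESTS l.72387) file #14 `sig_K2E1bNoDegOneOfNoPTypes` (M; SIGS-TABLE row 14, unit U3) ↦ seat K2E1b-p12.
THEOREMS ONLY (no `def`, no `instance`, no `notation`, no named-fact hypothesis, no `sorry`); imports = ★ `F0P3bKTypeIntegration` (`KIdx`, `kvec`,
`ActsOnKTypes`), ★ `F0P3bCochainValues` (`cval`, the values of a closed `(𝔤, K)`-1-cochain of type `δ`), ★ `F0P3bStubT6bDegOneTypeFinrank` (block-diagonal
elements of `𝔨` and their brackets on `𝔭`), ★ `GKModules` (`IsGKModule`) + HarnessLib; lane `--supports stmt-HodgeConjecture-24833 --as helper` (count-neutral: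
an input of the tier-0 assembly «DS-TABLE» `Theorems/K2E1bDsCarrierClass.lean`, it does not move 24833 by itself).

THE STATEMENT (bytes of the socket).  For every `K`-type datum `S ⊂ ℤ²` and every `(𝔤, K)`-module `(ρK, ρ𝔤)` of `U(2,1)` on the carrier
`V = KIdx S →₀ ℂ = ⊕_{(n,m) ∈ S} V_{n,m}` such that `ρ𝔤|_𝔨` acts on the `u`-basis by Kovačević's (untwisted) formulas (`ActsOnKTypes S ρ𝔤`), if
`(2, 3) ∉ S` and `(2, −3) ∉ S` then every degree-one Hodge piece of classes vanishes: `upqTypeClasses ρK ρ𝔤 _ 1 δ = ⊥` for all `δ : ℤ`.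
(The binder `∀ n m, (n, m) ∈ S → 1 ≤ n` is carried by the labels `KIdx S` and is not used.)

WHY THE LINE WANTS IT (card `K2_E1b_GKCohomologyU21.md`, unit U3; [BorelWallach2000, VI §4 (11), Thm. 4.11 (2)]; [Rogawski1990, Prop. 15.2.1 (a)]:
«`H^j(𝔤, K_∞, π ⊗ F) = ℂ` if `j = 2`, `0` otherwise» for `π` square integrable).  Relative `1`-cochains are `𝔨`-equivariant maps `𝔭 → V`
(`C¹ ⊂ Hom_𝔨(𝔭, V)`), and `𝔭_ℂ = 𝔭⁺ ⊕ 𝔭⁻` has `𝔨`-types exactly `V_{2,3} = std ⊗ u⁻¹` and `V_{2,−3} = std^∨ ⊗ u` in the ★ `kTypeMat` convention; so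
`H¹ = 0` as soon as these two labels are absent — the `K`-type criterion by which the tier-0 stub «DS-TABLE» reads `H¹(D) = 0` off Kovačević's data
(`holDS`, `antiholDS` on the locus, socket #13 `sig_K2E1bHolDsLocusWitness`).

THE PROOF (strategy: WEIGHTS + ONE `𝔰𝔩₂` PRODUCT, no irreducibility, no unitarity, no harmonic theory).  A class in `H¹_δ` is represented by a
`(𝔤, K)`-cocycle `f` of type `δ` (definition of ★ `upqTypeClasses`); we show `f = 0` (`cocycle_eq_zero`).  Off `δ = ±1` the type is empty
(★ `upq_eq_zero_of_mem_type`).  For `δ = ±1` the two values `u_p = f(X_{E_p}) ∈ V` (`p = 0, 1`; ★ `cval`) determine `f` (★ `cval_mem_span`), have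
`z₀`-weight `δ i` (★ `z0_cval`), and the cocycle identity on `𝔨` (★ `cval_lieK`: `f(⁅W, Y⁆) = ρW f(Y)`) with `f(JY) = δ i f(Y)` (★ `cval_upqUnit_I`) for
the root pair `W = E₀₁ − E₁₀`, `Q = i(E₀₁ + E₁₀)` of `𝔲(2) ⊂ 𝔨` gives `ρW u₁ = u₀`, `ρW u₀ = −u₁`, `ρQ u₀ = δ i u₁`, `ρQ u₁ = δ i u₀`.  Hence the product
`(ρW − iρQ)(−ρW − iρQ) = (2E₀₁)(2E₁₀)` multiplies `u₀` by `4` when `δ = 1` (resp. `u₁` when `δ = −1`).  On the other side `ActsOnKTypes` says: `ρz₀`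
is DIAGONAL on the basis `u^k_{n,m}` with eigenvalue `i m∕3` (`z0_single`) and `(2E₀₁)(2E₁₀)` is DIAGONAL with eigenvalue `4k(n−k)` (inside
`eq_zero_of_pin`, from the `u`-basis actions `2E₀₁ u^k = −2(k−1)(n+1−k) u^{k−1}`, `2E₁₀ u^k = −2 u^{k+1}` of `exists_root_pair`).  Reading eigenvalues on
the support of a `Finsupp` (`eigenvalue_eq_of_mem_support`): every label `(n, m, k)` in the support of the pinned value has `m = 3δ` and `k(n−k) = 1`,
i.e. `(n, m, k) = (2, 3δ, 1)` — excluded by `(2, ±3) ∉ S`.  So the pinned value vanishes, its partner `∓ρW` of it vanishes, and `f = 0`.  Declarations: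

* §1 `apply_eq_mul_of_diagonal`, `eigenvalue_eq_of_mem_support` · diagonal operators on `ι →₀ ℂ` [folklore];
* §2 `actsOnKTypes_apply` (the hypothesis read on `kInLie`), `z0_single` (`ρz₀ = i m∕3`), `exists_root_pair` (`W`, `Q`: brackets on `𝔭`, `2E₀₁`, `2E₁₀`);
* §3 `cval_neg`, `eq_zero_of_pin` (the `𝔰𝔩₂`-pin), `cocycle_eq_zero` (closed cochains of type `δ` vanish);
* §4 **`NoDegOneOfNoPTypes`** · `sig_K2E1bNoDegOneOfNoPTypes` TOKEN FOR TOKEN (tie probe `example : type_of% @NoDegOneOfNoPTypes =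
  type_of% @K2E1bGKCohomologyU21.U23.sig_K2E1bNoDegOneOfNoPTypes := rfl` at home once the socket module is built on stream 29:
  `K2/K2E1b-p12/g0/ProbeTie_K2E1bNoDegOneOfNoPTypes.lean`).

WHAT IS NOT HERE.  The converse∕dimension count (`H¹_δ ≅ Hom_𝔨(𝔭^δ, V)`, `dim = mult. of V_{2,3δ}`; sockets #16–#18 of U456), the class transport
(#15), the tier-0 assemblies; BW VI (11) `H^q(𝔤,K;V) = Hom_K(Λ^q 𝔭, V)` itself (unitary modules) is not used — only `C¹ ⊂ Hom_𝔨(𝔭, V)`.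

HONEST LABEL.  HC_CM is proved only modulo the 7 printed citations (2 remaining named inputs: hLiu418 = `stmt-HodgeConjecture-24832`, h413 =
`stmt-HodgeConjecture-24833`) until rung 0 closes; this file moves no counter.

## References
* [BorelWallach2000] A. Borel, N. Wallach, *Continuous cohomology, discrete subgroups, and representations of reductive groups*, 2nd ed.,
  Math. Surveys Monogr. 67 (2000): I §5.1 (the `(𝔤, K)`-complex), II §1.1 (3), §4.1–4.2 (`z₀`, types), VI §4 (11) and Thm. 4.11 (2)–(3) p. 168.
* [Rogawski1990] J. Rogawski, *Automorphic representations of unitary groups in three variables*, Ann. of Math. Stud. 123 (1990), §12.3 pp. 176–178,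
  Prop. 15.2.1 (a) p. 249.
* [Kovacevic2021] D. Kovačević, *Unitary `(𝔤,K)` modules of `SU(2,1)`*, Acta Math. Spalatensia 1 (2021) 105–125, §3 Def. 1 (the `u`-basis
  formulas behind `ActsOnKTypes`).
-/

set_option autoImplicit false
-- the mandated namespace repeats the single-problem summit's segment (`HodgeConjecture.HodgeConjecture`)
set_option linter.dupNamespace false

noncomputable section

namespace Summit.HodgeConjecture.HodgeConjecture.Cruxes.H413.K2E1bNoDegOneOfNoPTypes

open scoped Matrix
open Literature.Algebra.Lie Literature.Algebra.Lie.ChevalleyEilenberg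
open Literature.NumberTheory.Automorphic
open Literature.RepresentationTheory.BorelWallach2000
open Literature.RepresentationTheory.KonnoKonno2007 Literature.RepresentationTheory.KonnoKonno2007.RealDualPair
open Literature.RepresentationTheory.KonnoKonno2007.RealDualPair.UForm
open Summit.HodgeConjecture.HodgeConjecture.Cruxes.H413.F0P3bPPartOperators (neg_upqUnit)
open Summit.HodgeConjecture.HodgeConjecture.Cruxes.H413.F0P3bCochainValues
open Summit.HodgeConjecture.HodgeConjecture.Cruxes.H413.F0P3bStubT6bDegOneTypeFinrank
  (blockDiag_mem_lie blockDiag_mem_kInLie lie_blockDiag_upqUnit range_fin21)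
open Summit.HodgeConjecture.HodgeConjecture.Cruxes.H413.F0P3bKTypeIntegration
  (KIdx kvec kTypeRep ActsOnKTypes kvec_of_pos kvec_of_neg kvec_eq_single single_eq_kvec)

-- Mathlib idiom (as in `GKModules`, `GKCohomology`, the `Upq*` files and the socket module): commutator bracket on `Module.End`
attribute [local instance 100] LieRing.ofAssociativeRing

/-! ## §1 Diagonal operators on a `Finsupp` carrier: eigenvalues are read on the support -/

section Diagonal

variable {ι : Type} (T : (ι →₀ ℂ) →ₗ[ℂ] (ι →₀ ℂ)) (ev : ι → ℂ)

/-- A linear operator that is diagonal on the basis `(single t 1)` multiplies every coordinate by its eigenvalue. [folklore] -/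
theorem apply_eq_mul_of_diagonal (hT : ∀ t, T (Finsupp.single t 1) = ev t • Finsupp.single t 1) (v : ι →₀ ℂ) (t : ι) :
    T v t = ev t * v t := by
  induction v using Finsupp.induction_linear with
  | zero => rw [map_zero, Finsupp.zero_apply, mul_zero]
  | add f g hf hg => rw [map_add, Finsupp.add_apply, hf, hg, Finsupp.add_apply, mul_add]
  | single s c =>
    have hs : Finsupp.single s c = c • Finsupp.single s (1 : ℂ) := by
      rw [Finsupp.smul_single, smul_eq_mul, mul_one]
    classical
    rw [hs, map_smul, hT, smul_smul, Finsupp.smul_apply, Finsupp.smul_apply, Finsupp.single_apply, smul_eq_mul, smul_eq_mul]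
    by_cases h : s = t
    · subst h; simp only [if_true]; ring
    · rw [if_neg h, mul_zero, mul_zero, mul_zero]

/-- Hence on an eigenvector `T v = μ v` every label in the support has eigenvalue `μ`. [folklore] -/
theorem eigenvalue_eq_of_mem_support (hT : ∀ t, T (Finsupp.single t 1) = ev t • Finsupp.single t 1) (v : ι →₀ ℂ) (μ : ℂ)
    (hv : T v = μ • v) (t : ι) (ht : t ∈ v.support) : ev t = μ := by
  have h := apply_eq_mul_of_diagonal T ev hT v t
  rw [hv, Finsupp.smul_apply, smul_eq_mul] at h
  exact mul_right_cancel₀ (Finsupp.mem_support_iff.1 ht) h.symm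

end Diagonal

/-! ## §2 The `𝔨`-hypothesis `ActsOnKTypes` read on elements of `𝔨 ⊂ 𝔲(2,1)` -/

section KAction

variable {S : Set (ℤ × ℤ)} {ρ𝔤 : (uFormGroup (Fin 2) (Fin 1)).lie →ₗ⁅ℝ⁆ Module.End ℂ (KIdx S →₀ ℂ)}

/-- `ActsOnKTypes` (Kovačević's `u`-basis formulas, the route-posited `𝔨`-interface of ★ `F0P3bKTypeIntegration`) evaluated at an element
`X ∈ 𝔨` given as an element of `𝔤 = 𝔲(2,1)` (the hypothesis is stated on `compactLie`; `kInLie` is its image in `𝔤`).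
[cite: Kovacevic2021, §3 Def. 1] -/
theorem actsOnKTypes_apply (hρ : ActsOnKTypes S ρ𝔤) (X : (uFormGroup (Fin 2) (Fin 1)).lie)
    (hX : X ∈ (uFormGroup (Fin 2) (Fin 1)).kInLie) (n m k : ℤ) (hS : (n, m) ∈ S) (hk : 1 ≤ k) (hkn : k ≤ n) :
    ρ𝔤 X (kvec S n m k) =
      ((2 * (X : Matrix (Fin 2 ⊕ Fin 1) (Fin 2 ⊕ Fin 1) ℂ) (Sum.inl 0) (Sum.inl 0)
            - (X : Matrix (Fin 2 ⊕ Fin 1) (Fin 2 ⊕ Fin 1) ℂ) (Sum.inl 1) (Sum.inl 1)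
            - (X : Matrix (Fin 2 ⊕ Fin 1) (Fin 2 ⊕ Fin 1) ℂ) (Sum.inr 0) (Sum.inr 0)) / 3 * ((n : ℂ) + 1 - 2 * k)
        + ((X : Matrix (Fin 2 ⊕ Fin 1) (Fin 2 ⊕ Fin 1) ℂ) (Sum.inl 0) (Sum.inl 0)
            + (X : Matrix (Fin 2 ⊕ Fin 1) (Fin 2 ⊕ Fin 1) ℂ) (Sum.inl 1) (Sum.inl 1)
            - 2 * (X : Matrix (Fin 2 ⊕ Fin 1) (Fin 2 ⊕ Fin 1) ℂ) (Sum.inr 0) (Sum.inr 0)) / 3 *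
            (((m : ℂ) - n - 1 + 2 * k) / 2)) • kvec S n m k
      + (-((X : Matrix (Fin 2 ⊕ Fin 1) (Fin 2 ⊕ Fin 1) ℂ) (Sum.inl 0) (Sum.inl 1) *
          (((k : ℂ) - 1) * ((n : ℂ) + 1 - k)))) • kvec S n m (k - 1)
      + (-(X : Matrix (Fin 2 ⊕ Fin 1) (Fin 2 ⊕ Fin 1) ℂ) (Sum.inl 1) (Sum.inl 0)) • kvec S n m (k + 1) := by
  have hXc : (X : Matrix (Fin 2 ⊕ Fin 1) (Fin 2 ⊕ Fin 1) ℂ) ∈ (uFormGroup (Fin 2) (Fin 1)).compactLie :=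
    (RealMatrixGroup.mem_kInLie_iff _ X).1 hX
  have hinc : LieSubalgebra.inclusion (uFormGroup (Fin 2) (Fin 1)).compactLie_le_lie ⟨_, hXc⟩ = X := Subtype.ext rfl
  have h := hρ ⟨_, hXc⟩ n m k hS hk hkn
  rw [hinc] at h
  exact h

/-- **`ρ(z₀)` is diagonal with eigenvalue `i m ∕ 3` on `V_{n,m}`** (`z₀ = diag(i, i, 0)` of ★ `upqZ0`: in the `u`-basis formulas the `H_α`-part
`n+1−2k` carries the weight `(2i−i)∕3` and the `H_β`-part `(m−n−1+2k)∕2` the weight `2i∕3`, total `i m∕3`; `m` = eigenvalue of `Z = H_α + 2H_β`).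
[cite: Kovacevic2021, §3 Def. 1] [cite: BorelWallach2000, II §4.1] -/
theorem z0_single (hρ : ActsOnKTypes S ρ𝔤) (t : KIdx S) :
    ρ𝔤 (upqZ0 (Fin 2) (Fin 1)) (Finsupp.single t 1) = (((t.1.2.1 : ℤ) : ℂ) / 3 * Complex.I) • Finsupp.single t 1 := by
  obtain ⟨⟨n, m, k⟩, hS, hk, hkn⟩ := t
  dsimp only at hS hk hkn ⊢
  have e : Finsupp.single (⟨(n, m, k), hS, hk, hkn⟩ : KIdx S) (1 : ℂ) = kvec S n m k := (kvec_of_pos ⟨hS, hk, hkn⟩).symm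
  rw [e, actsOnKTypes_apply hρ _ upqZ0_mem_kInLie n m k hS hk hkn]
  simp only [coe_upqZ0, Matrix.fromBlocks_apply₁₁, Matrix.fromBlocks_apply₂₂, Matrix.smul_apply, Matrix.one_apply_eq,
    Matrix.one_apply_ne (show (0 : Fin 2) ≠ 1 by decide), Matrix.one_apply_ne (show (1 : Fin 2) ≠ 0 by decide),
    Matrix.zero_apply, smul_eq_mul, mul_one, mul_zero, neg_zero, zero_mul, zero_smul, add_zero, sub_zero]
  congr 1
  ring

/-- **The root vectors of `𝔨`**: `W = E₀₁ − E₁₀` and `Q = i(E₀₁ + E₁₀)` in `𝔲(2) ⊂ 𝔨`, with their brackets on `𝔭`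
(`⁅W, X_{cE_1}⁆ = X_{cE_0}`, `⁅W, X_{cE_0}⁆ = −X_{cE_1}`, `⁅Q, X_{cE_0}⁆ = X_{icE_1}`, `⁅Q, X_{cE_1}⁆ = X_{icE_0}`) and their `u`-basis action
(`ρW − iρQ = 2E₀₁ : u^k ↦ −2(k−1)(n+1−k) u^{k−1}`, `−ρW − iρQ = 2E₁₀ : u^k ↦ −2u^{k+1}`, from `X_α u^k = −(k−1)(n+1−k) u^{k−1}`, `Y_α u^k = −u^{k+1}`).
The block-diagonal `𝔨 = 𝔲(2) ⊕ 𝔲(1)` acts on `𝔭 ≅ M_{2×1}(ℂ)` by left multiplication (★ `lie_blockDiag_upqUnit`).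
[cite: BorelWallach2000, II §1.1 (3)] [cite: Kovacevic2021, §3 Def. 1] -/
theorem exists_root_pair (hρ : ActsOnKTypes S ρ𝔤) :
    ∃ W ∈ (uFormGroup (Fin 2) (Fin 1)).kInLie, ∃ Q ∈ (uFormGroup (Fin 2) (Fin 1)).kInLie,
      (∀ c : ℂ, ⁅W, upqUnit ((1 : Fin 2), (0 : Fin 1)) c⁆ = upqUnit ((0 : Fin 2), (0 : Fin 1)) c) ∧
      (∀ c : ℂ, ⁅W, upqUnit ((0 : Fin 2), (0 : Fin 1)) c⁆ = upqUnit ((1 : Fin 2), (0 : Fin 1)) (-c)) ∧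
      (∀ c : ℂ, ⁅Q, upqUnit ((0 : Fin 2), (0 : Fin 1)) c⁆ = upqUnit ((1 : Fin 2), (0 : Fin 1)) (Complex.I * c)) ∧
      (∀ c : ℂ, ⁅Q, upqUnit ((1 : Fin 2), (0 : Fin 1)) c⁆ = upqUnit ((0 : Fin 2), (0 : Fin 1)) (Complex.I * c)) ∧
      (∀ n m k : ℤ, (n, m) ∈ S → 1 ≤ k → k ≤ n →
        (ρ𝔤 W - Complex.I • ρ𝔤 Q) (kvec S n m k) = (-(2 * (((k : ℂ) - 1) * ((n : ℂ) + 1 - k)))) • kvec S n m (k - 1)) ∧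
      (∀ n m k : ℤ, (n, m) ∈ S → 1 ≤ k → k ≤ n →
        (-ρ𝔤 W - Complex.I • ρ𝔤 Q) (kvec S n m k) = (-2 : ℂ) • kvec S n m (k + 1)) := by
  -- `W = E₀₁ − E₁₀`
  have hA : (Matrix.single (0 : Fin 2) (1 : Fin 2) (1 : ℂ) - Matrix.single (1 : Fin 2) (0 : Fin 2) (1 : ℂ))ᴴ =
      -(Matrix.single (0 : Fin 2) (1 : Fin 2) (1 : ℂ) - Matrix.single (1 : Fin 2) (0 : Fin 2) (1 : ℂ)) := by
    rw [Matrix.conjTranspose_sub, Matrix.conjTranspose_single, Matrix.conjTranspose_single, star_one, neg_sub]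
  -- `Q = i(E₀₁ + E₁₀)`
  have hB : (Complex.I • (Matrix.single (0 : Fin 2) (1 : Fin 2) (1 : ℂ) + Matrix.single (1 : Fin 2) (0 : Fin 2) (1 : ℂ)))ᴴ =
      -(Complex.I • (Matrix.single (0 : Fin 2) (1 : Fin 2) (1 : ℂ) + Matrix.single (1 : Fin 2) (0 : Fin 2) (1 : ℂ))) := by
    rw [Matrix.conjTranspose_smul, Matrix.conjTranspose_add, Matrix.conjTranspose_single, Matrix.conjTranspose_single, star_one,
      Complex.star_def, Complex.conj_I, neg_smul, add_comm]
  refine ⟨⟨Matrix.fromBlocks (Matrix.single (0 : Fin 2) (1 : Fin 2) (1 : ℂ) - Matrix.single (1 : Fin 2) (0 : Fin 2) (1 : ℂ)) 0 0 0,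
      blockDiag_mem_lie _ hA⟩, blockDiag_mem_kInLie _ hA,
    ⟨Matrix.fromBlocks (Complex.I • (Matrix.single (0 : Fin 2) (1 : Fin 2) (1 : ℂ) + Matrix.single (1 : Fin 2) (0 : Fin 2) (1 : ℂ))) 0 0 0,
      blockDiag_mem_lie _ hB⟩, blockDiag_mem_kInLie _ hB, fun c => ?_, fun c => ?_, fun c => ?_, fun c => ?_,
    fun n m k hS hk hkn => ?_, fun n m k hS hk hkn => ?_⟩
  · rw [lie_blockDiag_upqUnit _ hA]
    apply Subtype.ext
    simp [Matrix.sub_mul, coe_upqUnit]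
  · rw [lie_blockDiag_upqUnit _ hA, ← neg_upqUnit]
    apply Subtype.ext
    rw [NegMemClass.coe_neg, coe_upqUnit, Matrix.fromBlocks_neg]
    simp [Matrix.sub_mul]
  · rw [lie_blockDiag_upqUnit _ hB]
    apply Subtype.ext
    simp [Matrix.add_mul, coe_upqUnit, Matrix.smul_single]
  · rw [lie_blockDiag_upqUnit _ hB]
    apply Subtype.ext
    simp [Matrix.add_mul, coe_upqUnit, Matrix.smul_single]
  · rw [LinearMap.sub_apply, LinearMap.smul_apply, actsOnKTypes_apply hρ _ (blockDiag_mem_kInLie _ hA) n m k hS hk hkn,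
      actsOnKTypes_apply hρ _ (blockDiag_mem_kInLie _ hB) n m k hS hk hkn]
    simp
    match_scalars <;> (simp only [← mul_assoc, Complex.I_mul_I]; ring)
  · rw [LinearMap.sub_apply, LinearMap.neg_apply, LinearMap.smul_apply,
      actsOnKTypes_apply hρ _ (blockDiag_mem_kInLie _ hA) n m k hS hk hkn,
      actsOnKTypes_apply hρ _ (blockDiag_mem_kInLie _ hB) n m k hS hk hkn]
    simp
    match_scalars <;> (simp only [← mul_assoc, Complex.I_mul_I]; ring)

end KAction

/-! ## §3 Closed `(𝔤, K)`-1-cochains of type `δ` vanish when the `𝔭`-types `(2, ±3)` are absent -/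

section Vanishing

variable {S : Set (ℤ × ℤ)}
  (ρK : Representation ℂ (uFormGroup (Fin 2) (Fin 1)).maximalCompact (KIdx S →₀ ℂ))
  (ρ𝔤 : (uFormGroup (Fin 2) (Fin 1)).lie →ₗ⁅ℝ⁆ Module.End ℂ (KIdx S →₀ ℂ))
  (hV : ∀ (k : (uFormGroup (Fin 2) (Fin 1)).maximalCompact) (X : (uFormGroup (Fin 2) (Fin 1)).lie),
    ρK k ∘ₗ ρ𝔤 X ∘ₗ ρK k⁻¹ =
      ρ𝔤 ((uFormGroup (Fin 2) (Fin 1)).Ad (Subgroup.inclusion (uFormGroup (Fin 2) (Fin 1)).maximalCompact_le_carrier k) X))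

/-- `f(−Y) = −f(Y)` for a `1`-cochain. [folklore] -/
theorem cval_neg (f : Cochain ℝ (uFormGroup (Fin 2) (Fin 1)).lie (GKCarrier (uFormGroup (Fin 2) (Fin 1)) ρ𝔤) 1)
    (Y : (uFormGroup (Fin 2) (Fin 1)).lie) : cval ρ𝔤 f (-Y) = -cval ρ𝔤 f Y := by
  rw [← neg_one_smul ℝ Y, cval_smul, Complex.ofReal_neg, Complex.ofReal_one, neg_one_smul]

/-- **The `𝔰𝔩₂`-pin.**  In `V = ⊕_{(n,m) ∈ S} V_{n,m}` with `ρ𝔤|_𝔨` acting by Kovačević's `u`-basis formulas, a vector `v` on which `z₀` acts by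
`δ i` and the product `(ρW − iρQ)(−ρW − iρQ) = (2E₀₁)(2E₁₀)` acts by `4` is supported on the single label `(n, m, k) = (2, 3δ, 1)` (`ρz₀ = i m∕3`
and `(2E₀₁)(2E₁₀) = 4k(n−k)` on `u^k_{n,m}`; `k(n−k) = 1` forces `k = 1`, `n = 2`); hence `v = 0` when `(2, 3δ) ∉ S` (`𝔭^± ≅ V_{2,±3}` are the
only `K`-types with these two eigenvalues).  [cite: Kovacevic2021, §3 Def. 1] [cite: BorelWallach2000, VI Thm. 4.11 (2)] -/
theorem eq_zero_of_pin (hρ : ActsOnKTypes S ρ𝔤) {W Q : (uFormGroup (Fin 2) (Fin 1)).lie}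
    (hE01 : ∀ n m k : ℤ, (n, m) ∈ S → 1 ≤ k → k ≤ n →
      (ρ𝔤 W - Complex.I • ρ𝔤 Q) (kvec S n m k) = (-(2 * (((k : ℂ) - 1) * ((n : ℂ) + 1 - k)))) • kvec S n m (k - 1))
    (hE10 : ∀ n m k : ℤ, (n, m) ∈ S → 1 ≤ k → k ≤ n →
      (-ρ𝔤 W - Complex.I • ρ𝔤 Q) (kvec S n m k) = (-2 : ℂ) • kvec S n m (k + 1))
    (δ : ℤ) (hδS : ((2 : ℤ), 3 * δ) ∉ S) (v : KIdx S →₀ ℂ)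
    (hz : ρ𝔤 (upqZ0 (Fin 2) (Fin 1)) v = ((δ : ℂ) * Complex.I) • v)
    (hP : ((ρ𝔤 W - Complex.I • ρ𝔤 Q) * (-ρ𝔤 W - Complex.I • ρ𝔤 Q)) v = (4 : ℂ) • v) : v = 0 := by
  -- the product is diagonal with eigenvalue `4k(n−k)` on `u^k_{n,m}`
  have hdiag : ∀ t : KIdx S, ((ρ𝔤 W - Complex.I • ρ𝔤 Q) * (-ρ𝔤 W - Complex.I • ρ𝔤 Q)) (Finsupp.single t 1) =
      (4 * ((t.1.2.2 : ℤ) : ℂ) * (((t.1.1 : ℤ) : ℂ) - t.1.2.2)) • Finsupp.single t 1 := by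
    rintro ⟨⟨n, m, k⟩, hS, hk, hkn⟩
    dsimp only at hS hk hkn ⊢
    rw [← kvec_of_pos ⟨hS, hk, hkn⟩, Module.End.mul_apply, hE10 n m k hS hk hkn, map_smul]
    rcases lt_or_eq_of_le hkn with hlt | heq
    · rw [hE01 n m (k + 1) hS (by omega) (by omega), smul_smul, add_sub_cancel_right]
      congr 1
      push_cast
      ring
    · rw [kvec_of_neg (n := n) (m := m) (k := k + 1) (fun h => absurd h.2.2 (by omega)), map_zero, smul_zero, heq, sub_self,
        mul_zero, zero_smul]
  -- read the two eigenvalues on the support of `v`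
  refine Finsupp.ext fun t => ?_
  rw [Finsupp.zero_apply]
  by_contra hvt
  have ht : t ∈ v.support := Finsupp.mem_support_iff.2 hvt
  have hm := eigenvalue_eq_of_mem_support (ρ𝔤 (upqZ0 (Fin 2) (Fin 1)))
    (fun t : KIdx S => ((t.1.2.1 : ℤ) : ℂ) / 3 * Complex.I) (z0_single hρ) v _ hz t ht
  have hk := eigenvalue_eq_of_mem_support _ _ hdiag v _ hP t ht
  obtain ⟨⟨n, m, k⟩, hS, hk1, hkn⟩ := t
  dsimp only at hm hk hS hk1 hkn
  -- `m = 3δ`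
  have hm' : m = 3 * δ := by
    have h1 : ((m : ℂ)) / 3 = δ := mul_right_cancel₀ Complex.I_ne_zero hm
    rw [div_eq_iff (by norm_num : (3 : ℂ) ≠ 0)] at h1
    have h2 : m = δ * 3 := by exact_mod_cast h1
    rw [h2, mul_comm]
  -- `k(n − k) = 1`, so `k = 1`, `n = 2`
  have hkn' : k * (n - k) = 1 := by
    have h1 : ((k * (n - k) : ℤ) : ℂ) = ((1 : ℤ) : ℂ) := by
      push_cast
      linear_combination hk / 4
    exact_mod_cast h1
  have hk' : k = 1 := Int.eq_one_of_mul_eq_one_right (by omega) hkn'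
  have hn' : n = 2 := by
    rw [hk', one_mul] at hkn'
    omega
  subst hk' hn' hm'
  exact hδS hS

include hV in
/-- **Every closed `(𝔤, K)`-1-cochain `f` of type `δ` of `V = ⊕_{(n,m) ∈ S} V_{n,m}` vanishes when `(2, 3), (2, −3) ∉ S`.**  Off `δ = ±1` the type is
empty (★ `upq_eq_zero_of_mem_type`).  For `δ = ±1` the values `u_p = f(X_{E_p})` (`p = 0, 1`) have `z₀`-weight `δ i` (★ `z0_cval`) and, by the cocycle
identity `f(⁅W, Y⁆) = ρW f(Y)` on `𝔨` (★ `cval_lieK`) with `f(JY) = δ i f(Y)` (★ `cval_upqUnit_I`), the root pair acts by `ρW u₁ = u₀`, `ρW u₀ = −u₁`,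
`ρQ u₀ = δ i u₁`, `ρQ u₁ = δ i u₀`; so `(2E₀₁)(2E₁₀)` fixes `u₀` times `4` if `δ = 1` (resp. `u₁` if `δ = −1`) and `eq_zero_of_pin` kills it, the partner
being `∓ρW` of it; every value of `f` lies in the span of `u₀, u₁` (★ `cval_mem_span`).  [cite: BorelWallach2000, VI §4 (11); VI Thm. 4.11 (2)]
[cite: Rogawski1990, Prop. 15.2.1 (a)] -/
theorem cocycle_eq_zero (hρ : ActsOnKTypes S ρ𝔤) (h23 : ((2 : ℤ), (3 : ℤ)) ∉ S) (h2m3 : ((2 : ℤ), (-3 : ℤ)) ∉ S) {δ : ℤ}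
    (f : Cochain ℝ (uFormGroup (Fin 2) (Fin 1)).lie (GKCarrier (uFormGroup (Fin 2) (Fin 1)) ρ𝔤) 1)
    (hf : f ∈ upqType ρK ρ𝔤 hV 1 δ)
    (hd : d ℝ (uFormGroup (Fin 2) (Fin 1)).lie (GKCarrier (uFormGroup (Fin 2) (Fin 1)) ρ𝔤) 1 f = 0) : f = 0 := by
  -- off `δ = ±1` the type is empty
  by_cases hδ : δ = 1 ∨ δ = -1
  swap
  · obtain ⟨hδ1, hδ2⟩ := not_or.1 hδ
    refine upq_eq_zero_of_mem_type ρK ρ𝔤 hV (fun k hk => ?_) f hf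
    rcases Nat.le_one_iff_eq_zero_or_eq_one.1 hk with rfl | rfl
    · norm_num
      exact hδ2
    · norm_num
      exact hδ1
  -- the root pair and the two values `u_p = f(X_{E_p})`
  obtain ⟨W, hW, Q, hQ, hW1, hW0, hQ0, hQ1, hE01, hE10⟩ := exists_root_pair hρ
  have hWu1 : ρ𝔤 W (cval ρ𝔤 f (upqUnit ((1 : Fin 2), (0 : Fin 1)) 1)) = cval ρ𝔤 f (upqUnit ((0 : Fin 2), (0 : Fin 1)) 1) := by
    rw [← cval_lieK ρK ρ𝔤 hV f hf hd W hW, hW1]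
  have hWu0 : ρ𝔤 W (cval ρ𝔤 f (upqUnit ((0 : Fin 2), (0 : Fin 1)) 1)) = -cval ρ𝔤 f (upqUnit ((1 : Fin 2), (0 : Fin 1)) 1) := by
    rw [← cval_lieK ρK ρ𝔤 hV f hf hd W hW, hW0, ← neg_upqUnit, cval_neg]
  have hQu0 : ρ𝔤 Q (cval ρ𝔤 f (upqUnit ((0 : Fin 2), (0 : Fin 1)) 1)) =
      ((δ : ℂ) * Complex.I) • cval ρ𝔤 f (upqUnit ((1 : Fin 2), (0 : Fin 1)) 1) := by
    rw [← cval_lieK ρK ρ𝔤 hV f hf hd Q hQ, hQ0, cval_upqUnit_I ρK ρ𝔤 hV f hf hd]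
  have hQu1 : ρ𝔤 Q (cval ρ𝔤 f (upqUnit ((1 : Fin 2), (0 : Fin 1)) 1)) =
      ((δ : ℂ) * Complex.I) • cval ρ𝔤 f (upqUnit ((0 : Fin 2), (0 : Fin 1)) 1) := by
    rw [← cval_lieK ρK ρ𝔤 hV f hf hd Q hQ, hQ1, cval_upqUnit_I ρK ρ𝔤 hV f hf hd]
  -- both values vanish
  have h01 : cval ρ𝔤 f (upqUnit ((0 : Fin 2), (0 : Fin 1)) 1) = 0 ∧ cval ρ𝔤 f (upqUnit ((1 : Fin 2), (0 : Fin 1)) 1) = 0 := by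
    rcases hδ with rfl | rfl
    · -- `δ = 1`: pin `u₀`; then `u₁ = −ρW u₀`
      have hI : Complex.I * (((1 : ℤ) : ℂ) * Complex.I) = -1 := by rw [Int.cast_one, one_mul, Complex.I_mul_I]
      have h10 : (-ρ𝔤 W - Complex.I • ρ𝔤 Q) (cval ρ𝔤 f (upqUnit ((0 : Fin 2), (0 : Fin 1)) 1)) =
          (2 : ℂ) • cval ρ𝔤 f (upqUnit ((1 : Fin 2), (0 : Fin 1)) 1) := by
        rw [LinearMap.sub_apply, LinearMap.neg_apply, LinearMap.smul_apply, hWu0, hQu0, smul_smul, hI]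
        module
      have h01' : (ρ𝔤 W - Complex.I • ρ𝔤 Q) (cval ρ𝔤 f (upqUnit ((1 : Fin 2), (0 : Fin 1)) 1)) =
          (2 : ℂ) • cval ρ𝔤 f (upqUnit ((0 : Fin 2), (0 : Fin 1)) 1) := by
        rw [LinearMap.sub_apply, LinearMap.smul_apply, hWu1, hQu1, smul_smul, hI]
        module
      have hP : ((ρ𝔤 W - Complex.I • ρ𝔤 Q) * (-ρ𝔤 W - Complex.I • ρ𝔤 Q)) (cval ρ𝔤 f (upqUnit ((0 : Fin 2), (0 : Fin 1)) 1)) =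
          (4 : ℂ) • cval ρ𝔤 f (upqUnit ((0 : Fin 2), (0 : Fin 1)) 1) := by
        rw [Module.End.mul_apply, h10, map_smul, h01', smul_smul]
        norm_num
      have h0 := eq_zero_of_pin ρ𝔤 hρ hE01 hE10 1 (by simpa using h23) _ (z0_cval ρK ρ𝔤 hV f hf _) hP
      refine ⟨h0, ?_⟩
      rw [← neg_neg (cval ρ𝔤 f (upqUnit ((1 : Fin 2), (0 : Fin 1)) 1)), ← hWu0, h0, map_zero, neg_zero]
    · -- `δ = −1`: pin `u₁`; then `u₀ = ρW u₁`
      have hI : Complex.I * (((-1 : ℤ) : ℂ) * Complex.I) = 1 := by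
        rw [Int.cast_neg, Int.cast_one, neg_one_mul, mul_neg, Complex.I_mul_I, neg_neg]
      have h10 : (-ρ𝔤 W - Complex.I • ρ𝔤 Q) (cval ρ𝔤 f (upqUnit ((1 : Fin 2), (0 : Fin 1)) 1)) =
          (-2 : ℂ) • cval ρ𝔤 f (upqUnit ((0 : Fin 2), (0 : Fin 1)) 1) := by
        rw [LinearMap.sub_apply, LinearMap.neg_apply, LinearMap.smul_apply, hWu1, hQu1, smul_smul, hI]
        module
      have h01' : (ρ𝔤 W - Complex.I • ρ𝔤 Q) (cval ρ𝔤 f (upqUnit ((0 : Fin 2), (0 : Fin 1)) 1)) =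
          (-2 : ℂ) • cval ρ𝔤 f (upqUnit ((1 : Fin 2), (0 : Fin 1)) 1) := by
        rw [LinearMap.sub_apply, LinearMap.smul_apply, hWu0, hQu0, smul_smul, hI]
        module
      have hP : ((ρ𝔤 W - Complex.I • ρ𝔤 Q) * (-ρ𝔤 W - Complex.I • ρ𝔤 Q)) (cval ρ𝔤 f (upqUnit ((1 : Fin 2), (0 : Fin 1)) 1)) =
          (4 : ℂ) • cval ρ𝔤 f (upqUnit ((1 : Fin 2), (0 : Fin 1)) 1) := by
        rw [Module.End.mul_apply, h10, map_smul, h01', smul_smul]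
        norm_num
      have h1 := eq_zero_of_pin ρ𝔤 hρ hE01 hE10 (-1) (by simpa using h2m3) _ (z0_cval ρK ρ𝔤 hV f hf _) hP
      refine ⟨?_, h1⟩
      rw [← hWu1, h1, map_zero]
  -- hence `f = 0`: every value lies in the span of `u₀, u₁`
  rw [eq_zero_iff_cval]
  intro Y
  have hY := cval_mem_span ρK ρ𝔤 hV f hf hd Y
  rw [range_fin21] at hY
  obtain ⟨a, b, hab⟩ := Submodule.mem_span_pair.1 hY
  rw [← hab, h01.1, h01.2, smul_zero, smul_zero, add_zero]

end Vanishing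

/-! ## §4 The socket `sig_K2E1bNoDegOneOfNoPTypes`, token for token -/

/-- **Socket #14 `sig_K2E1bNoDegOneOfNoPTypes` of `Cruxes/H413/Lines/K2_E1b_GKCohomologyU21_U23_CarriersData.lean` (statement bytes frozen).**
`H¹_δ = 0` WHEN THE `𝔭`-TYPES ARE ABSENT: if `ρ𝔤|_𝔨` acts on `V = ⊕_{(n,m) ∈ S} V_{n,m}` by Kovačević's (untwisted) `u`-basis formulas and neither
label `(2, 3)` nor `(2, −3)` occurs, every degree-one Hodge piece of classes `H¹_δ(𝔲(2,1), K; V)` is `⊥`: a class of type `δ` is represented by a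
`(𝔤, K)`-cocycle of type `δ` (definition of ★ `upqTypeClasses`), which vanishes by `cocycle_eq_zero` — relative `1`-cochains are `𝔨`-equivariant on
`𝔭`, and `𝔭_ℂ = 𝔭⁺ ⊕ 𝔭⁻` has `𝔨`-types `V_{2,3} = std ⊗ u⁻¹`, `V_{2,−3} = std^∨ ⊗ u`, read here through `z₀ = i m∕3` and the `𝔰𝔩₂` product `E₀₁E₁₀`.
The hypothesis `1 ≤ n` on `S` is not needed (it is carried by the labels `KIdx S`).  [cite: BorelWallach2000, VI §4 (11); VI Thm. 4.11 (2)]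
[cite: Rogawski1990, Prop. 15.2.1 (a)] -/
theorem NoDegOneOfNoPTypes :
    ∀ (S : Set (ℤ × ℤ)) (ρK : Representation ℂ (uFormGroup (Fin 2) (Fin 1)).maximalCompact (KIdx S →₀ ℂ))
      (ρ𝔤 : (uFormGroup (Fin 2) (Fin 1)).lie →ₗ⁅ℝ⁆ Module.End ℂ (KIdx S →₀ ℂ))
      (hGK : IsGKModule (uFormGroup (Fin 2) (Fin 1)) ρK ρ𝔤),
      (∀ n m : ℤ, (n, m) ∈ S → 1 ≤ n) → ActsOnKTypes S ρ𝔤 →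
        ((2 : ℤ), (3 : ℤ)) ∉ S → ((2 : ℤ), (-3 : ℤ)) ∉ S →
          ∀ δ : ℤ, upqTypeClasses ρK ρ𝔤 hGK.ad_compat 1 δ = ⊥ := by
  intro S ρK ρ𝔤 hGK _ hρ h23 h2m3 δ
  rw [Submodule.eq_bot_iff]
  intro x hx
  obtain ⟨z, hz, rfl⟩ := Submodule.mem_map.1 hx
  have hzt : (z : Cochain ℝ (uFormGroup (Fin 2) (Fin 1)).lie (GKCarrier (uFormGroup (Fin 2) (Fin 1)) ρ𝔤) 1) ∈
      upqType ρK ρ𝔤 hGK.ad_compat 1 δ := Submodule.mem_comap.1 hz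
  obtain ⟨-, hzd⟩ := ((gkComplex (uFormGroup (Fin 2) (Fin 1)) ρK ρ𝔤 hGK.ad_compat).mem_cocycles_iff 1 _).1 z.2
  have h0 : z = 0 := Subtype.ext (cocycle_eq_zero ρK ρ𝔤 hGK.ad_compat hρ h23 h2m3 _ hzt hzd)
  rw [h0, map_zero]

end Summit.HodgeConjecture.HodgeConjecture.Cruxes.H413.K2E1bNoDegOneOfNoPTypes

end
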